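import Mathlib
import Literature.Computability.AlgebraicComplexity.NestFreeMatchingPoly
import Summits.ValiantsHypothesis.ValiantsHypothesis.Theorems.FifoMatchingNNDivisionHardLocalCofactor
import HarnessLib

/-!
# Route FifoMatching — crux `NNDivisionHard` (stmt-ValiantsHypothesis-21181): local cofactors — the BLOCK-LOCAL and
# WINDOW-LOCAL instances of the face reduction

Instances of `LocalCofactor.complexity_avoidingFace_le_of_local` (a cofactor supported on an arc set `I` avoided by some
nest-free perfect matching is at least as expensive as the `I`-avoiding face `NN_n^{¬I}`), with the shift matching `i ↦ i ± n`
(all arcs of length `n`) as the avoiding matching: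

* ★ `complexity_crossFace_le_of_blockLocal` — **BLOCK-LOCAL COFACTORS** (every variable `x_(i,j)` has `⌊i/2β⌋ = ⌊j/2β⌋`, i.e.
  lies inside one block of the uniform aligned partition into blocks of length `2β ≤ n`; e.g. the block products
  `Π_t ι_t(NN_β)`, the conjectural test member of the by-name tiers of record): `L₊(NN_n^{cross}) ≤ L₊(NN_n · h) + 1`, where
  `NN_n^{cross}` is the sum over the nest-free perfect matchings with NO arc inside a block;
* ★ `complexity_windowAvoidingFace_le_of_windowLocal` — **WINDOW-LOCAL COFACTORS** (every variable inside a window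
  `[s, s+G)`, `G ≤ n`, any alignment): `L₊(NN_n^{no arc inside the window}) ≤ L₊(NN_n · h) + 1`.

The lower bounds for these faces are the missing input (thick-queue measure support, see `…ShortLocalConditional`).
HONEST FRAMING: reductions; stmt-21181 stays OPEN; nothing here bears on `NNNotVP` or on VP ≠ VNP (NOT proved).
References: Bürgisser 2000 Rem. 2.7 [Burgisser2000]; Hrubeš–Yehudayoff 2021 §6 Problem 2 [HrubesYehudayoff2021].
-/

noncomputable section

-- Sub = Summit single-conjunct layout: the duplicated namespace component is mandated by the tree.
set_option linter.dupNamespace false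
set_option autoImplicit false

namespace Summit.ValiantsHypothesis.ValiantsHypothesis.Theorems.FifoMatching.NNDivisionHard.LocalCofactor

open Finset MvPolynomial Literature.Computability.AlgebraicComplexity
open Summit.ValiantsHypothesis.ValiantsHypothesis.Theorems.FifoMatching.NNDivisionHard.StackPowersQueue
  (shiftMatching shiftMatching_mem)
open scoped NNReal BigOperators

variable {n : ℕ}

/-- The arcs of the shift matching have length exactly `n`: `M i = i + n` on openers. [folklore] -/
theorem shiftMatching_opener_val {i : Fin (2 * n)} (hi : i ∈ openers (shiftMatching n)) :
    ((shiftMatching n i : Fin (2 * n)) : ℕ) = (i : ℕ) + n := by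
  rw [mem_openers, Fin.lt_def] at hi
  simp only [shiftMatching] at hi ⊢
  split_ifs at hi ⊢ with h
  · rfl
  · omega

/-- ★ **BLOCK-LOCAL COFACTORS reduce to the block-crossing face.**  For the uniform aligned partition of `[0, 2n)` into blocks
of length `2β` (`1 ≤ β`, `2β ≤ n`): if every variable `x_(i,j)` of `h ≠ 0` lies inside one block (`⌊i/2β⌋ = ⌊j/2β⌋`), then
`L₊(NN_n^{cross}) ≤ L₊(NN_n · h) + 1`. [cite: Burgisser2000, Rem. 2.7] -/
theorem complexity_crossFace_le_of_blockLocal {β : ℕ} (hβ : 1 ≤ β) (hβn : 2 * β ≤ n)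
    {h : MvPolynomial (Fin (2 * n) × Fin (2 * n)) ℝ≥0} (hh : h ≠ 0)
    (hloc : ∀ e ∈ h.vars, (e.1 : ℕ) / (2 * β) = (e.2 : ℕ) / (2 * β)) :
    complexity (∑ M ∈ (nestFreeMatchings (2 * n)).filter (fun M => ∀ i ∈ openers M,
        (i, M i) ∉ (univ : Finset (Fin (2 * n) × Fin (2 * n))).filter
          (fun e => (e.1 : ℕ) / (2 * β) = (e.2 : ℕ) / (2 * β))),
        arcMonomial ℝ≥0 M) ≤ complexity (nestFreeMatchingPoly n ℝ≥0 * h) + 1 := by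
  refine complexity_avoidingFace_le_of_local _ ⟨shiftMatching n, shiftMatching_mem n, fun i hi hmem => ?_⟩ hh
    fun e he => Finset.mem_filter.2 ⟨Finset.mem_univ _, hloc e he⟩
  have hv := shiftMatching_opener_val hi
  have hq := (Finset.mem_filter.1 hmem).2
  simp only at hq
  rw [hv] at hq
  -- `i / 2β = (i + n) / 2β` is impossible for `2β ≤ n`
  have h1 : ((i : ℕ) + n) / (2 * β) ≥ ((i : ℕ) + 2 * β) / (2 * β) := Nat.div_le_div_right (by omega)
  rw [Nat.add_div_right _ (by omega)] at h1
  omega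

/-- ★ **WINDOW-LOCAL COFACTORS reduce to the window-avoiding face.**  If every variable `x_(i,j)` of `h ≠ 0` lies inside the
window `[s, s+G)` with `G ≤ n` (any alignment), then `L₊(NN_n^{no arc inside [s,s+G)}) ≤ L₊(NN_n · h) + 1`.
[cite: Burgisser2000, Rem. 2.7] -/
theorem complexity_windowAvoidingFace_le_of_windowLocal {s G : ℕ} (hG : G ≤ n)
    {h : MvPolynomial (Fin (2 * n) × Fin (2 * n)) ℝ≥0} (hh : h ≠ 0)
    (hloc : ∀ e ∈ h.vars, s ≤ (e.1 : ℕ) ∧ (e.1 : ℕ) < s + G ∧ s ≤ (e.2 : ℕ) ∧ (e.2 : ℕ) < s + G) :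
    complexity (∑ M ∈ (nestFreeMatchings (2 * n)).filter (fun M => ∀ i ∈ openers M,
        (i, M i) ∉ (univ : Finset (Fin (2 * n) × Fin (2 * n))).filter
          (fun e => s ≤ (e.1 : ℕ) ∧ (e.1 : ℕ) < s + G ∧ s ≤ (e.2 : ℕ) ∧ (e.2 : ℕ) < s + G)),
        arcMonomial ℝ≥0 M) ≤ complexity (nestFreeMatchingPoly n ℝ≥0 * h) + 1 := by
  refine complexity_avoidingFace_le_of_local _ ⟨shiftMatching n, shiftMatching_mem n, fun i hi hmem => ?_⟩ hh
    fun e he => Finset.mem_filter.2 ⟨Finset.mem_univ _, hloc e he⟩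
  have hv := shiftMatching_opener_val hi
  have hq := (Finset.mem_filter.1 hmem).2
  simp only at hq
  rw [hv] at hq
  rw [mem_openers, Fin.lt_def, hv] at hi
  omega

end Summit.ValiantsHypothesis.ValiantsHypothesis.Theorems.FifoMatching.NNDivisionHard.LocalCofactor

end
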